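import Literature.MathematicalPhysics.QuantumLattice.HeisenbergModel
import HarnessLib

/-!
# Griffiths–Ginibre monotonicity for the spin-½ quantum XY model (Benassi–Lees–Ueltschi 2016, Cor. 2)

`MathematicalPhysics/QuantumLattice` named-fact file, in the vocabulary of `SpinSystem.lean` /
`HeisenbergModel.lean` / `FinDimSpectrum.lean` (`siteSpin`, `spinBond`, `Matrix.gibbsState`).
Source: C. Benassi, B. Lees, D. Ueltschi, *Correlation inequalities for the quantum XY model*,
J. Stat. Phys. 164 (2016) 1157–1166 = arXiv:1510.03215 (held: paper:arxiv-1510.03215, §1–§2 read,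
materialised chunks p0003–p0004). Bib key `BenassiLeesUeltschi2016`.

Setting (§1, verbatim): finite `Λ`, `𝓗_Λ = ⊗_{x∈Λ} ℂ^{2S+1}`, spin operators `S¹, S², S³`,
`H_Λ = −Σ_{A ⊂ Λ} (J¹_A Π_{x∈A} S¹_x + J²_A Π_{x∈A} S²_x)` with `J^i_A ≥ 0`, Gibbs state
`⟨a⟩ = Tr a e^{−βH_Λ}/Z(Λ)`.

> **Theorem 1.** Assume that `J^i_A ≥ 0` for all `A ⊂ Λ` and all `i ∈ {1,2}`. Assume also that
> `S = ½`. Then for all `A, B ⊂ Λ`, and all `s ∈ [0,1]`,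
> `⟨Π_A S¹ ; Π_B S¹⟩_s − ⟨Π_A S¹⟩⟨Π_B S¹⟩ ≥ 0` and `⟨Π_A S¹ ; Π_B S²⟩_s − ⟨Π_A S¹⟩⟨Π_B S²⟩ ≤ 0`.
>
> **Corollary 2.** Under the same assumptions as in the above theorem, we have for all `A, B ⊂ Λ`
> that `∂/∂J¹_A ⟨Π_{x∈B} S¹_x⟩ ≥ 0` and `∂/∂J¹_A ⟨Π_{x∈B} S²_x⟩ ≤ 0`.

("The first inequality states that correlations increase when the coupling constants increase (in
the same spin direction)"; proof: Ginibre's structure, §3.) §2 uses Corollary 2 to build the Gibbs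
state with `+` boundary conditions (Prop. 4: `H⁺_Λ = H_Λ − Σ_{A∩∂_RΛ≠∅} 2^{−|A∩∂_RΛ|} J¹_A Π_{A∩Λ} S¹`,
i.e. for nearest-neighbour pairs a boundary FIELD `½ J¹` per exterior neighbour in direction 1) and
its thermodynamic limit for `⟨Π_A S^i⟩⁺_Λ` (Thm. 5, by monotonicity in `Λ`), and closes: "Much work
remains to be done to make this rigorous" (spontaneous magnetisation of `⟨·⟩⁺`).

**Vendored** as `benassiLeesUeltschi2016_cor2`: the INTEGRATED first inequality of Corollary 2
(monotonicity, which is what the derivative sign means for the real-analytic map `J ↦ ⟨·⟩`) in the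
special case of couplings supported on PAIRS `{x,y}` (edges of a graph `G`) and SINGLETONS `{x}`
(fields), and observables `Π_B S¹` with `|B| ≤ 2`: for the spin-½ pair-plus-field XY Hamiltonian
`xyPairFieldHamiltonian G K₀ K₁ h₀ h₁ = −Σ_{{x,y}∈E(G)} (K₀ S⁰_xS⁰_y + K₁ S¹_xS¹_y) − Σ_x (h₀ S⁰_x + h₁ S¹_x)`
(tree spin directions `0, 1` = the paper's `1, 2`; spin `½` = local dimension `2`, i.e. `n = 1` in
`siteSpin 1`), all coefficients nonnegative, RAISING the direction-`0` couplings `K₀ ≤ K₀'` and fields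
`h₀ ≤ h₀'` (pointwise) does not lower `Re⟨S⁰_x⟩_β` nor `Re⟨S⁰_x S⁰_y⟩_β`. This is weaker than the
printed corollary (fewer `A`, fewer `B`), never stronger; `x = y` gives the constant observable
`(S⁰_x)² = ¼` (equality, harmless). The second inequality, Theorem 1 itself (Schwinger functions) and
the `S = 1` ground-state Theorem 3 are NOT vendored.

Grounds: `Summit.AtomisticToContinuum.BoseEinsteinCondensation.Theses.BECBoundaryReservoir.LatticeSourceGriffiths`
(item stmt-AtomisticToContinuum-8769) AT `μ = 0` — there the statement is literally this fact with
`K₀ = K₁ = 1` on the box graph and `h₁ = 0` (`xyPairFieldHamiltonian_one_one_eq`), the `μ ≠ 0` case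
being the item's open content — and the monotonicity joints of
`….BECBoundaryReservoir.BoundaryFieldMagnetisation` (stmt-AtomisticToContinuum-8770: BLU Prop. 4 /
Thm. 5 `+` boundary fields `n_x/2` in direction `0`).

## References

* C. Benassi, B. Lees, D. Ueltschi, J. Stat. Phys. 164 (2016) = arXiv:1510.03215, Thm. 1, **Cor. 2**,
  Prop. 4, Thm. 5. [BenassiLeesUeltschi2016]
* J. Ginibre, *General formulation of Griffiths' inequalities*, Comm. Math. Phys. 16 (1970) 310–328
  (the structure behind Thm. 1). [Ginibre1970]
-/

noncomputable section

open Matrix Complex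

namespace Literature.MathematicalPhysics.QuantumLattice

variable {Λ : Type*} [Fintype Λ] [DecidableEq Λ]

/-- The spin-½ **pair-plus-field quantum XY Hamiltonian** of Benassi–Lees–Ueltschi (their `H_Λ`
with couplings supported on the edges of `G` and on singletons):
`H = −Σ_{{x,y} ∈ E(G)} (K₀{x,y} S⁰_x S⁰_y + K₁{x,y} S¹_x S¹_y) − Σ_x (h₀ x · S⁰_x + h₁ x · S¹_x)` on
`⊗_{x∈Λ} ℂ²` (`Op Λ 2`). With `K₀ = K₁ = 1`, `h₁ = 0` it is the XY model `xxzHamiltonian 1 G (-1) 0`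
in an in-plane field `h₀` (`xyPairFieldHamiltonian_one_one_eq`).
[cite: BenassiLeesUeltschi2016, §1 (Hamiltonian H_Λ) and Prop. 4] -/
def xyPairFieldHamiltonian (G : SimpleGraph Λ) [DecidableRel G.Adj]
    (K₀ K₁ : Sym2 Λ → ℝ) (h₀ h₁ : Λ → ℝ) : Op Λ 2 :=
  -(∑ e ∈ G.edgeFinset,
      Sym2.lift ⟨fun x y => (K₀ e : ℂ) • spinBond 1 0 x y + (K₁ e : ℂ) • spinBond 1 1 x y,
        fun x y => by simp only [spinBond_comm]⟩ e) -
    ∑ x : Λ, ((h₀ x : ℂ) • siteSpin 1 x 0 + (h₁ x : ℂ) • siteSpin 1 x 1)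

/-- The isotropic unit-coupling case with a field in direction `0` only is the tree's XY Hamiltonian
`xxzHamiltonian 1 G (-1) 0 = −Σ_{E(G)} (S⁰S⁰ + S¹S¹)` minus the field term — the form in which route
BECBoundaryReservoir writes its lattice cruxes. [cite: BenassiLeesUeltschi2016, §1 (Hamiltonian H_Λ)] -/
theorem xyPairFieldHamiltonian_one_one_eq (G : SimpleGraph Λ) [DecidableRel G.Adj] (h₀ : Λ → ℝ) :
    xyPairFieldHamiltonian G (fun _ => 1) (fun _ => 1) h₀ (fun _ => 0) =
      xxzHamiltonian 1 G (-1) 0 - ∑ x : Λ, (h₀ x : ℂ) • siteSpin 1 x 0 := by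
  unfold xyPairFieldHamiltonian xxzHamiltonian
  have hsum : ∀ e ∈ G.edgeFinset,
      Sym2.lift ⟨fun x y => ((1 : ℝ) : ℂ) • spinBond (Λ := Λ) 1 0 x y + ((1 : ℝ) : ℂ) • spinBond 1 1 x y,
        fun x y => by simp only [spinBond_comm]⟩ e =
      Sym2.lift ⟨fun x y => spinBond (Λ := Λ) 1 0 x y + spinBond 1 1 x y + ((0 : ℝ) : ℂ) • spinBond 1 2 x y,
        fun x y => by simp only [spinBond_comm]⟩ e := by
    intro e _
    induction e using Sym2.ind with
    | h x y => simp
  rw [Finset.sum_congr rfl hsum]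
  simp only [ofReal_neg, ofReal_one, neg_smul, one_smul, ofReal_zero, zero_smul, add_zero]

/-- **Benassi–Lees–Ueltschi 2016, Corollary 2 (first inequality; Griffiths–Ginibre monotonicity
for the spin-½ quantum XY model), pair-plus-field case, observables of degree ≤ 2.** For every
finite `Λ`, graph `G`, inverse temperature `β > 0`, nonnegative couplings `K₀ ≤ K₀'`, `K₁` and
nonnegative fields `h₀ ≤ h₀'`, `h₁` (pointwise inequalities), and all sites `x, y`:
`Re⟨S⁰_x⟩ ` and `Re⟨S⁰_x S⁰_y⟩` in the Gibbs state of `xyPairFieldHamiltonian G K₀ K₁ h₀ h₁` are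
`≤` the same expectations for `xyPairFieldHamiltonian G K₀' K₁ h₀' h₁` — "correlations increase when
the coupling constants increase (in the same spin direction)", the integrated form of
`∂/∂J¹_A ⟨Π_{x∈B} S¹_x⟩ ≥ 0` for `|A|, |B| ≤ 2`. Printed for all finite `A, B ⊂ Λ` (general
multi-spin couplings); `S = ½` and `J ≥ 0` are essential (Ginibre's cone). Grounds the `μ = 0` case
of `Summit.AtomisticToContinuum.BoseEinsteinCondensation.Theses.BECBoundaryReservoir.LatticeSourceGriffiths`
and the monotonicity joints of `….BECBoundaryReservoir.BoundaryFieldMagnetisation`.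
[cite: BenassiLeesUeltschi2016, Cor. 2 (with Thm. 1; arXiv:1510.03215 §1)] -/
def benassiLeesUeltschi2016_cor2 : Prop :=
  ∀ (Λ : Type) [Fintype Λ] [DecidableEq Λ] (G : SimpleGraph Λ) [DecidableRel G.Adj] (β : ℝ),
    0 < β →
    ∀ (K₀ K₀' K₁ : Sym2 Λ → ℝ) (h₀ h₀' h₁ : Λ → ℝ),
      (∀ e, 0 ≤ K₀ e ∧ K₀ e ≤ K₀' e) → (∀ e, 0 ≤ K₁ e) →
      (∀ x, 0 ≤ h₀ x ∧ h₀ x ≤ h₀' x) → (∀ x, 0 ≤ h₁ x) →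
      ∀ x y : Λ,
        (Matrix.gibbsState β (xyPairFieldHamiltonian G K₀ K₁ h₀ h₁) (siteSpin 1 x 0)).re ≤
            (Matrix.gibbsState β (xyPairFieldHamiltonian G K₀' K₁ h₀' h₁) (siteSpin 1 x 0)).re ∧
          (Matrix.gibbsState β (xyPairFieldHamiltonian G K₀ K₁ h₀ h₁)
              (siteSpin 1 x 0 * siteSpin 1 y 0)).re ≤
            (Matrix.gibbsState β (xyPairFieldHamiltonian G K₀' K₁ h₀' h₁)
              (siteSpin 1 x 0 * siteSpin 1 y 0)).re

/-- The field-only instance in the route's form: under the fact, for the XY model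
`xxzHamiltonian 1 G (-1) 0` in nonnegative direction-`0` fields, `Re⟨S⁰_x⟩_β` is non-decreasing in
the field configuration — item `LatticeSourceGriffiths` of route BECBoundaryReservoir at `μ = 0`.
[cite: BenassiLeesUeltschi2016, Cor. 2] -/
theorem benassiLeesUeltschi2016_cor2.field_monotone (hBLU : benassiLeesUeltschi2016_cor2)
    {Λ : Type} [Fintype Λ] [DecidableEq Λ] (G : SimpleGraph Λ) [DecidableRel G.Adj] {β : ℝ}
    (hβ : 0 < β) {h h' : Λ → ℝ} (hh : ∀ y, 0 ≤ h y ∧ h y ≤ h' y) (x : Λ) :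
    (Matrix.gibbsState β (xxzHamiltonian 1 G (-1) 0 - ∑ y : Λ, (h y : ℂ) • siteSpin 1 y 0)
        (siteSpin 1 x 0)).re ≤
      (Matrix.gibbsState β (xxzHamiltonian 1 G (-1) 0 - ∑ y : Λ, (h' y : ℂ) • siteSpin 1 y 0)
        (siteSpin 1 x 0)).re := by
  have := (hBLU Λ G β hβ (fun _ => 1) (fun _ => 1) (fun _ => 1) h h' (fun _ => 0)
    (fun _ => ⟨zero_le_one, le_rfl⟩) (fun _ => zero_le_one) hh (fun _ => le_rfl) x x).1
  simpa only [xyPairFieldHamiltonian_one_one_eq] using this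

end Literature.MathematicalPhysics.QuantumLattice

end
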